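import Summits.ABC.IUTFork.Cor312LogKummerRoute2Checks
import HarnessLib

/-!
# [IUTchIII] Cor. 3.12 — refutation wiring for the B-INPUT at a packet where the volumes separate (TEAM B)

Record-only file (D-0012) of the abc-iut cell (Cor. 3.12 STRATEGY TEAM B «estimate / log-Kummer»,
HUMAN RULING D-0067 (3), seat abc-iut-c312-11 = B1; §1 of the DH-sharp composition agreed with A2
03:02:54Z — frames sibling p418519 cited, not re-derived; the DH instantiation follows on c312-3 g4's
GO with their volume formulas); TAKES NO SIDE. The GAP row G-c312-11-1 nominates the per-packet
B-INPUT family (`VolumeTransport` / `QFrobComparison` / `QFrobEqualityAt`); its prove-in-cone branch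
asks whether these hold at the assembled real settings. This file provides the GENERIC refutation
wiring — if at ONE packet `(j = i+1, v_ℚ)` every single Kummer image of the Θ-pilot object has
mono-analytic log-volume strictly BELOW the `q`-pilot contribution, then:

* `not_volumeTransport_of_packet_lt` — layer 1's `VolumeTransport` FAILS (and with it every uniform
  `VolumeTransportAt m`);
* `not_qFrobComparison_of_packet_lt` / `not_qFrobEqualityAt_of_packet_lt` — under the typed
  Thm. 3.11 (ii) (a) (`Column.KummerA`) and admissibility of the Kummer images, the layer-2 forms
  (the holomorphic (xi-g) comparison and its printed uniform equality form, the decls the row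
  nominates) FAIL too — through the landed iff-bridges of `Cor312LogKummerRoute2Checks` (p413508).

The strict volume separation itself is INSTANCE DATA (the `j²`-scaling of the Θ-ideles at a deep bad
place — witness carriers per A2's p418519 census: S-lane/c312-3/c312-5); nothing here asserts it.
At the frames container the per-packet refutation of the pointwise reading from named instance
inputs is Team A's `not_pointwise_ofFrameVolumes_of_deep` (p418519) — this file is its
ROUTE-DECL-level wiring so the refutation lands on exactly the decls G-c312-11-1 names. Sources:
[IUTchIII] p. 184 l. 30–34 (Step (xi-g)); [IUTchIV] p. 27 Step (v). [claim: Mochizuki2012, status: disputed]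
[cite: ScholzeStix2018, §2.2 pp. 9–10]
Deliberately NOT here: the DH-sharp volume computations (c312-3's files; §2 on their GO), any witness
data, any judgement on Cor. 3.12 or its gap rows.
-/

noncomputable section

namespace Summit.ABC

namespace IUTFork

namespace Cor312Vol

open Thm311 Cor312

section SituationLevel

variable {T : ThetaIndex} {S : Situation T} (P : Cor312.Setting S)

/-- **Layer-1 refutation wiring**: if at ONE packet `(j = i+1, v_ℚ)` every single Kummer image of
the Θ-pilot object has mono-analytic log-volume strictly below the `q`-pilot contribution, then
`VolumeTransport` fails — the `≤`-form of the (xi-g) comparison cannot hold there for any choice of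
lattice position. [folklore] -/
theorem not_volumeTransport_of_packet_lt (i : Fin T.lstar) (vQ : T.VQ)
    (h : ∀ m : ℤ, (S.D P.n).logvol (Setting.labelSucc i) vQ
      (P.thetaRegion m (Setting.labelSucc i) vQ) < P.qLocal (Setting.labelSucc i) vQ) :
    ¬ VolumeTransport P := by
  intro hvt
  obtain ⟨m, hm⟩ := hvt i vQ
  exact absurd hm (not_le.2 (h m))

/-- The uniform forms fail as well (for every `m₀`). [folklore] -/
theorem not_volumeTransportAt_of_packet_lt (i : Fin T.lstar) (vQ : T.VQ)
    (h : ∀ m : ℤ, (S.D P.n).logvol (Setting.labelSucc i) vQ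
      (P.thetaRegion m (Setting.labelSucc i) vQ) < P.qLocal (Setting.labelSucc i) vQ) (m₀ : ℤ) :
    ¬ VolumeTransportAt P m₀ :=
  fun hat => not_volumeTransport_of_packet_lt P i vQ h (volumeTransport_of_at hat)

end SituationLevel

section LatticeLevel

variable {T : ThetaIndex} {S' : LatticeSituation T} (P : Cor312.Setting S'.toSituation)

/-- **Layer-2 refutation wiring, `≤`-form**: under the typed Thm. 3.11 (ii) (a) at the column
(`Column.KummerA`) and admissibility of the Kummer images, the strict volume separation at one
packet refutes the holomorphic (xi-g) comparison `QFrobComparison` — the first decl GAP row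
G-c312-11-1 nominates (through the landed `qFrobComparison_iff_volumeTransport`, p413508).
[folklore] -/
theorem not_qFrobComparison_of_packet_lt (hka : (S'.col P.n).KummerA (S'.D P.n))
    (hadm : ThetaRegionsAdm P) (i : Fin T.lstar) (vQ : T.VQ)
    (h : ∀ m : ℤ, (S'.D P.n).logvol (Setting.labelSucc i) vQ
      (P.thetaRegion m (Setting.labelSucc i) vQ) < P.qLocal (Setting.labelSucc i) vQ) :
    ¬ QFrobComparison P := fun hq =>
  not_volumeTransport_of_packet_lt P i vQ h
    ((qFrobComparison_iff_volumeTransport P hka hadm).1 hq)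

/-- **Layer-2 refutation wiring, printed uniform equality form**: the same separation refutes
`QFrobEqualityAt P m` at EVERY lattice position `m` — the second decl the row nominates (through the
landed `qFrobEqualityAt_iff`). [folklore] -/
theorem not_qFrobEqualityAt_of_packet_lt (hka : (S'.col P.n).KummerA (S'.D P.n))
    (hadm : ThetaRegionsAdm P) (i : Fin T.lstar) (vQ : T.VQ)
    (h : ∀ m : ℤ, (S'.D P.n).logvol (Setting.labelSucc i) vQ
      (P.thetaRegion m (Setting.labelSucc i) vQ) < P.qLocal (Setting.labelSucc i) vQ) (m : ℤ) :
    ¬ QFrobEqualityAt P m := fun hq =>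
  not_qFrobComparison_of_packet_lt P hka hadm i vQ h (qFrobComparison_of_equalityAt hq)

/-- BOOKKEEPING for the census: the strict separation at one packet leaves the whole nominated
per-packet B-INPUT family false at once — `VolumeTransport`, every `VolumeTransportAt m₀`,
`QFrobComparison`, and every `QFrobEqualityAt m` (under (ii) (a) + admissible Kummer images).
[folklore] -/
theorem bInput_family_false_of_packet_lt (hka : (S'.col P.n).KummerA (S'.D P.n))
    (hadm : ThetaRegionsAdm P) (i : Fin T.lstar) (vQ : T.VQ)
    (h : ∀ m : ℤ, (S'.D P.n).logvol (Setting.labelSucc i) vQ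
      (P.thetaRegion m (Setting.labelSucc i) vQ) < P.qLocal (Setting.labelSucc i) vQ) :
    ¬ VolumeTransport P ∧ (∀ m₀ : ℤ, ¬ VolumeTransportAt P m₀) ∧ ¬ QFrobComparison P ∧
      ∀ m : ℤ, ¬ QFrobEqualityAt P m :=
  ⟨not_volumeTransport_of_packet_lt P i vQ h, not_volumeTransportAt_of_packet_lt P i vQ h,
    not_qFrobComparison_of_packet_lt P hka hadm i vQ h,
    not_qFrobEqualityAt_of_packet_lt P hka hadm i vQ h⟩

end LatticeLevel

end Cor312Vol

end IUTFork

end Summit.ABC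

end
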